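/-
Copyright: the b2b-balaban T⁴-continuum CRUX team, row NE7b leaf lineage `t4-ne7b-formalise-leaf-05` (gen 156). Project licence.
-/
import Summits.QuantumFields.BalabanUV.T4Continuum.Spine.NE7b.NonAbelianStokesDisc

/-!
# (NAS) part 4 — THE TRANSPOSITION SCRIPT: swapping two adjacent letters of a lattice word is a script of `NonAbelianStokesDisc`
# that glues AT MOST ONE plaquette (exactly one when the two letters are not parallel, none when they are), at an explicit corner
# with an explicit orientation (row NE7b, node U5c; the elementary step of «two lattice paths with the same letters have
# `ε`-close transports» — Lemma CS (ii) of `HOME/b2b-balaban-r1/SectE-interface-proof.md`: «the two transports connect the same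
# endpoints by fine paths … enclosing O(d) unit squares»)

Cell `pub-balaban`, sub-cell `t4`, spine estimate NE7b (`T4WeightBudget.RelWeightBound`; the cell's OWN estimate — NOT PRINTED in [Bałaban 1983–89],
NOT PROVED).  Crux-route work under `Spine/NE7b/` by a row leaf; [folklore] list bookkeeping on lattice words; NOTHING of Bałaban's is named,
asserted or valued; no `T4Continuum/Support` leaf typed; EIGHT data definitions (script fragments `ppMoves`, `sdMoves`, `mpMoves`, `pmMoves`,
`mmMoves`, `swapMoves`; the glued plaquette's orientation `swapOrient` and corner offset `swapShift` — list- ∕ site-valued, no `Prop`-valued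
definition); zero `sorry`.  Imports leaf-01's BUILT `NonAbelianStokesDisc` ONLY (`Move`, `Move.apply`, `build`, `loops`, `glued`, `build_backtrack ∕
_loop ∕ _cancel` BY NAME) — fileable today; §0 states the three moves' effect on `build` in «positioned» form (`build ms = A ++ …`, `|A| = n`).

WHY (located).  Lemma CS (ii) compares the transports along two fine lattice paths with the same endpoints — in the cell's instance the
tree contour followed by a straight segment, `Γ · [x, x + L e_μ]`, against the segment followed by the translated contour,
`[y, y + L e_μ] · (Γ + L e_μ)`: two words that are PERMUTATIONS of each other (`treeWord r ++ seg μ L` and `seg μ L ++ treeWord r` in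
`B7Prop1Explicit`'s vocabulary).  The loop «out along one, back along the other» bounds a disc made of the unit squares swept by the
letters as they are sorted past each other; (NAS) prices it by one plaquette per transposition of non-parallel letters.  THIS FILE is the
elementary step: the script of ONE adjacent transposition, in all four sign cases, with the glued plaquette named (corner and orientation);
the sequel `NonAbelianStokesPathPair` sorts a whole word and draws the (NAS) consequence.

THE MOVES (word `X ++ l₁ l₂ ++ Y`, `|X| = n`, swap point `p = x + disp X`; scripts listed head = applied LAST).
* `l₁ l₂ = a⁺ b⁺` (`ppMoves`): insert `∂p_{ba} = b⁺a⁺b⁻a⁻` at position `n` (`a⁺b⁺ = ∂p_{ab} · b⁺a⁺`, so `b⁺a⁺ = ∂p_{ba}⁻¹…` — concretely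
  `X b⁺a⁺b⁻a⁻ a⁺b⁺ Y`), cancel `a⁻a⁺` (position `n+3`), cancel `b⁻b⁺` (position `n+2`): result `X b⁺ a⁺ Y`; glued: `∂p_{ba}` at `p`.
* `a⁻ b⁺` (`mpMoves`): backtrack `a⁺a⁻` at `n+2`, the `pp` swap of `b⁺a⁺` at `n+1`, cancel `a⁻a⁺` at `n`; glued: `∂p_{ab}` at `p − e_a`.
* `a⁺ b⁻` (`pmMoves`): backtrack `b⁻b⁺` at `n`, the `pp` swap of `b⁺a⁺` at `n+1`, cancel `b⁺b⁻` at `n+2`; glued: `∂p_{ab}` at `p − e_b`.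
* `a⁻ b⁻` (`mmMoves`): backtrack `b⁻b⁺` at `n`, the `pm` swap of `b⁺a⁻` at `n+1`, cancel `b⁺b⁻` at `n+2`; glued: `∂p_{ba}` at `p − e_a − e_b`.
* parallel letters (`a = b`): equal letters — nothing; opposite letters `aˢ a^{¬s}` (`sdMoves`) — cancel then re-insert the backtrack the
  other way round; no plaquette.
In words: the glued plaquette is the unit square with corners `p`, `p + v₁`, `p + v₂`, `p + v₁ + v₂` (`vᵢ` the letters' vectors), read from
its lower corner `p + swapShift l₁ l₂`, with orientation `(b, a)` for equal signs and `(a, b)` for opposite signs (`swapOrient`).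

WHAT IS PROVED ([folklore]): §0 `build_backtrack_of_eq` ∕ `build_loop_of_eq` ∕ `build_cancel_of_eq` (a move at position `|A|` acts between `A` and
the rest; the cancel FIRES on `A ++ l l⁻¹ ++ C`); then for each fragment `F ∈ {pp, sd, mp, pm, mm, swap}Moves` and every `rest` with `build rest = X ++ l₁ :: l₂ :: Y`,
`|X| = n`: **`build_F_append`** (`build (F ++ rest) = X ++ l₂ :: l₁ :: Y` — the letters ARE swapped), **`loops_F_append`** and
**`glued_F_append`** (the ONE glued plaquette, literally a `plaqWord`, at the named corner; none for `sdMoves`); for `swapMoves`: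
`build_swapMoves_append`, `loops_swapMoves_append` ∕ `glued_swapMoves_append` (`= (if l₁.1 = l₂.1 then [] else [the plaquette]) ++ …`),
`length_glued_swapMoves_append_le` (at most one), `exists_eq_plaqWord_of_mem_loops_swapMoves_append` (every new inserted word is
`plaqWord a b` with `a ≠ b`).  §5 toys: `a⁺b⁺ ↦ b⁺a⁺` on the bare two-letter word, and the `a⁻b⁻` case.

NOT HERE (honest): sorting a whole word ∕ the (NAS) consequence (`NonAbelianStokesPathPair`); the linearised reading (`LinearisedLatticeStokesDisc`
applies verbatim to these scripts — junction left to a successor once the oleans exist); which paths are Bałaban's ((A3) ∕ (A1c), NC-NE7b-α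
UNRULED).  BY-NAME EFFECT ON THE WALL: NONE.  NE7b NOT PRINTED ∕ NOT PROVED; spine PROVED 0∕9; rung (B)+1 on a FINITE torus — NOT infinite
volume, NOT the mass gap, NOT Clay.  HONEST DEPENDENCY: continuum YM on T⁴ ⇐ BetaPertH ∧ nine spine estimates (0/9 proved); BetaPertH ⇐ (D1) ∧
(D4) ∧ CAP+tail; G-an2-4 gates asym, D1 and NE2/3/4.
-/

set_option autoImplicit false

namespace Summit.QuantumFields.BalabanUV.T4Continuum.NE7b.NonAbelianStokesTransposition

open Literature.MathematicalPhysics.QuantumFieldTheory.Balaban1983to89.B7Prop1Explicit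
  (Site Letter e disp disp_append disp_cons plaqWord)
open NonAbelianStokesDisc

variable {d : ℕ}

/-! ## §0 The three moves at a position, in `build` form -/

section Positioned

/-- A backtrack move at position `|A|`: `build ms = A ++ B` ⟹ `build (backtrack |A| l :: ms) = A ++ l l⁻¹ ++ B`. [folklore] -/
theorem build_backtrack_of_eq {ms : List (Move d)} {A B : List (Letter d)} {n : ℕ} (l : Letter d) (hms : build ms = A ++ B)
    (hA : A.length = n) : build (Move.backtrack n l :: ms) = A ++ l :: l.rev :: B := by
  rw [build_backtrack, hms, List.take_left' hA, List.drop_left' hA]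

/-- A loop move at position `|A|`: `build ms = A ++ B` ⟹ `build (loop |A| σ :: ms) = A ++ σ ++ B`. [folklore] -/
theorem build_loop_of_eq {ms : List (Move d)} {A B : List (Letter d)} {n : ℕ} (σ : List (Letter d)) (hms : build ms = A ++ B)
    (hA : A.length = n) : build (Move.loop n σ :: ms) = A ++ σ ++ B := by
  rw [build_loop, hms, List.take_left' hA, List.drop_left' hA]

/-- A cancel move at position `|A|` FIRES on `A ++ l l⁻¹ ++ C`: `build (cancel |A| l :: ms) = A ++ C`. [folklore] -/
theorem build_cancel_of_eq {ms : List (Move d)} {A C : List (Letter d)} {n : ℕ} (l : Letter d) (hms : build ms = A ++ l :: l.rev :: C)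
    (hA : A.length = n) : build (Move.cancel n l :: ms) = A ++ C := by
  have hd : (A ++ l :: l.rev :: C).drop n = l :: l.rev :: C := List.drop_left' hA
  have ht : (l :: l.rev :: C).take 2 = [l, l.rev] := rfl
  have h2 : (A ++ [l, l.rev]).length = n + 2 := by simp [hA]
  rw [build_cancel, hms, hd, if_pos ht, List.take_left' hA, show A ++ l :: l.rev :: C = (A ++ [l, l.rev]) ++ C by simp, List.drop_left' h2]

end Positioned

/-! ## §1 The primitive: `a⁺ b⁺ ↦ b⁺ a⁺` -/

section PP

/-- DATA.  The `pp` fragment at position `n`: insert `∂p_{ba}` at `n`, cancel `a⁻a⁺` at `n + 3`, cancel `b⁻b⁺` at `n + 2` (head applied last). -/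
def ppMoves (a b : Fin d) (n : ℕ) : List (Move d) :=
  [Move.cancel (n + 2) (b, false), Move.cancel (n + 3) (a, false), Move.loop n (plaqWord b a)]

/-- Unfolding `ppMoves a b n ++ rest`. -/
theorem ppMoves_append (a b : Fin d) (n : ℕ) (rest : List (Move d)) :
    ppMoves a b n ++ rest = Move.cancel (n + 2) (b, false) :: Move.cancel (n + 3) (a, false) :: Move.loop n (plaqWord b a) :: rest := rfl

/-- **THE `pp` FRAGMENT SWAPS `a⁺ b⁺ ↦ b⁺ a⁺`.** [folklore] -/
theorem build_ppMoves_append (a b : Fin d) {n : ℕ} (X Y : List (Letter d)) (hX : X.length = n) (rest : List (Move d))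
    (hrest : build rest = X ++ (a, true) :: (b, true) :: Y) :
    build (ppMoves a b n ++ rest) = X ++ (b, true) :: (a, true) :: Y := by
  have h1 : build (Move.loop n (plaqWord b a) :: rest) =
      (X ++ [((b, true) : Letter d), (a, true), (b, false)]) ++ (a, false) :: Letter.rev ((a, false) : Letter d) :: ((b, true) :: Y) := by
    rw [build_loop_of_eq _ hrest hX]; simp [plaqWord]
  have h2 : build (Move.cancel (n + 3) (a, false) :: Move.loop n (plaqWord b a) :: rest) =
      (X ++ [((b, true) : Letter d), (a, true)]) ++ (b, false) :: Letter.rev ((b, false) : Letter d) :: Y := by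
    rw [build_cancel_of_eq _ h1 (by simp [hX])]; simp
  rw [ppMoves_append, build_cancel_of_eq _ h2 (by simp [hX])]; simp

/-- The `pp` fragment inserts exactly one word, `∂p_{ba}`. [folklore] -/
theorem loops_ppMoves_append (a b : Fin d) (n : ℕ) (rest : List (Move d)) :
    loops (ppMoves a b n ++ rest) = plaqWord b a :: loops rest := rfl

/-- … glued at the swap point `x + disp X`. [folklore] -/
theorem glued_ppMoves_append (a b : Fin d) (x : Site d) {n : ℕ} (X Y : List (Letter d)) (hX : X.length = n) (rest : List (Move d))
    (hrest : build rest = X ++ (a, true) :: (b, true) :: Y) :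
    glued x (ppMoves a b n ++ rest) = (x + disp X, plaqWord b a) :: glued x rest := by
  rw [ppMoves_append, glued, glued, glued, hrest, List.take_left' hX]

end PP

/-! ## §2 Parallel letters of opposite sign: `aˢ a^{¬s} ↦ a^{¬s} aˢ` without a plaquette -/

section SD

/-- DATA.  The same-direction fragment: cancel the backtrack `aˢ a^{¬s}` at `n`, re-insert it as `a^{¬s} aˢ` (head applied last). -/
def sdMoves (a : Fin d) (s : Bool) (n : ℕ) : List (Move d) := [Move.backtrack n (a, !s), Move.cancel n (a, s)]

/-- Unfolding `sdMoves a s n ++ rest`. -/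
theorem sdMoves_append (a : Fin d) (s : Bool) (n : ℕ) (rest : List (Move d)) :
    sdMoves a s n ++ rest = Move.backtrack n (a, !s) :: Move.cancel n (a, s) :: rest := rfl

/-- **THE `sd` FRAGMENT SWAPS `aˢ a^{¬s} ↦ a^{¬s} aˢ`.** [folklore] -/
theorem build_sdMoves_append (a : Fin d) (s : Bool) {n : ℕ} (X Y : List (Letter d)) (hX : X.length = n) (rest : List (Move d))
    (hrest : build rest = X ++ (a, s) :: (a, !s) :: Y) :
    build (sdMoves a s n ++ rest) = X ++ (a, !s) :: (a, s) :: Y := by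
  have h1 : build (Move.cancel n (a, s) :: rest) = X ++ Y :=
    build_cancel_of_eq _ (by rw [hrest]; rfl) hX
  rw [sdMoves_append, build_backtrack_of_eq _ h1 hX, Letter.rev_mk, Bool.not_not]

/-- The `sd` fragment inserts no word … -/
theorem loops_sdMoves_append (a : Fin d) (s : Bool) (n : ℕ) (rest : List (Move d)) :
    loops (sdMoves a s n ++ rest) = loops rest := rfl

/-- … and glues nothing. -/
theorem glued_sdMoves_append (a : Fin d) (s : Bool) (x : Site d) (n : ℕ) (rest : List (Move d)) :
    glued x (sdMoves a s n ++ rest) = glued x rest := rfl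

end SD

/-! ## §3 The other three sign cases, reduced to the primitive by one backtrack -/

section Signs

/-- DATA.  `a⁻ b⁺ ↦ b⁺ a⁻`: backtrack `a⁺a⁻` at `n + 2`, `pp`-swap `b⁺a⁺` at `n + 1`, cancel `a⁻a⁺` at `n` (head applied last). -/
def mpMoves (a b : Fin d) (n : ℕ) : List (Move d) :=
  Move.cancel n (a, false) :: (ppMoves b a (n + 1) ++ [Move.backtrack (n + 2) (a, true)])

/-- DATA.  `a⁺ b⁻ ↦ b⁻ a⁺`: backtrack `b⁻b⁺` at `n`, `pp`-swap `b⁺a⁺` at `n + 1`, cancel `b⁺b⁻` at `n + 2` (head applied last). -/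
def pmMoves (a b : Fin d) (n : ℕ) : List (Move d) :=
  Move.cancel (n + 2) (b, true) :: (ppMoves b a (n + 1) ++ [Move.backtrack n (b, false)])

/-- DATA.  `a⁻ b⁻ ↦ b⁻ a⁻`: backtrack `b⁻b⁺` at `n`, `pm`-swap `b⁺a⁻` at `n + 1`, cancel `b⁺b⁻` at `n + 2` (head applied last). -/
def mmMoves (a b : Fin d) (n : ℕ) : List (Move d) :=
  Move.cancel (n + 2) (b, true) :: (pmMoves b a (n + 1) ++ [Move.backtrack n (b, false)])

/-- **`mpMoves` SWAPS `a⁻ b⁺ ↦ b⁺ a⁻`.** [folklore] -/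
theorem build_mpMoves_append (a b : Fin d) {n : ℕ} (X Y : List (Letter d)) (hX : X.length = n) (rest : List (Move d))
    (hrest : build rest = X ++ (a, false) :: (b, true) :: Y) :
    build (mpMoves a b n ++ rest) = X ++ (b, true) :: (a, false) :: Y := by
  have h1 : build (Move.backtrack (n + 2) (a, true) :: rest) = (X ++ [((a, false) : Letter d)]) ++ (b, true) :: (a, true) :: ((a, false) :: Y) := by
    rw [build_backtrack_of_eq (A := X ++ [((a, false) : Letter d), (b, true)]) (B := Y) _ (by rw [hrest]; simp) (by simp [hX])]
    simp
  have h2 := build_ppMoves_append b a (n := n + 1) (X ++ [((a, false) : Letter d)]) ((a, false) :: Y) (by simp [hX]) _ h1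
  rw [mpMoves, List.cons_append, List.append_assoc, List.singleton_append,
    build_cancel_of_eq (A := X) (C := (b, true) :: (a, false) :: Y) _ (by rw [h2]; simp) hX]

/-- `mpMoves` inserts exactly one word, `∂p_{ab}` … -/
theorem loops_mpMoves_append (a b : Fin d) (n : ℕ) (rest : List (Move d)) :
    loops (mpMoves a b n ++ rest) = plaqWord a b :: loops rest := rfl

/-- … glued at `x + disp X − e_a`. [folklore] -/
theorem glued_mpMoves_append (a b : Fin d) (x : Site d) {n : ℕ} (X Y : List (Letter d)) (hX : X.length = n) (rest : List (Move d))
    (hrest : build rest = X ++ (a, false) :: (b, true) :: Y) :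
    glued x (mpMoves a b n ++ rest) = (x + disp X - e a, plaqWord a b) :: glued x rest := by
  have h1 : build (Move.backtrack (n + 2) (a, true) :: rest) = (X ++ [((a, false) : Letter d)]) ++ (b, true) :: (a, true) :: ((a, false) :: Y) := by
    rw [build_backtrack_of_eq (A := X ++ [((a, false) : Letter d), (b, true)]) (B := Y) _ (by rw [hrest]; simp) (by simp [hX])]
    simp
  rw [mpMoves, List.cons_append, List.append_assoc, List.singleton_append, glued,
    glued_ppMoves_append b a x (n := n + 1) (X ++ [((a, false) : Letter d)]) ((a, false) :: Y) (by simp [hX]) _ h1, glued, disp_append]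
  simp [disp_cons, sub_eq_add_neg, add_assoc]

/-- **`pmMoves` SWAPS `a⁺ b⁻ ↦ b⁻ a⁺`.** [folklore] -/
theorem build_pmMoves_append (a b : Fin d) {n : ℕ} (X Y : List (Letter d)) (hX : X.length = n) (rest : List (Move d))
    (hrest : build rest = X ++ (a, true) :: (b, false) :: Y) :
    build (pmMoves a b n ++ rest) = X ++ (b, false) :: (a, true) :: Y := by
  have h1 : build (Move.backtrack n (b, false) :: rest) = (X ++ [((b, false) : Letter d)]) ++ (b, true) :: (a, true) :: ((b, false) :: Y) := by
    rw [build_backtrack_of_eq _ hrest hX]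
    simp
  have h2 := build_ppMoves_append b a (n := n + 1) (X ++ [((b, false) : Letter d)]) ((b, false) :: Y) (by simp [hX]) _ h1
  rw [pmMoves, List.cons_append, List.append_assoc, List.singleton_append,
    build_cancel_of_eq (A := X ++ [((b, false) : Letter d), (a, true)]) (C := Y) _ (by rw [h2]; simp) (by simp [hX])]
  simp

/-- `pmMoves` inserts exactly one word, `∂p_{ab}` … -/
theorem loops_pmMoves_append (a b : Fin d) (n : ℕ) (rest : List (Move d)) :
    loops (pmMoves a b n ++ rest) = plaqWord a b :: loops rest := rfl

/-- … glued at `x + disp X − e_b`. [folklore] -/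
theorem glued_pmMoves_append (a b : Fin d) (x : Site d) {n : ℕ} (X Y : List (Letter d)) (hX : X.length = n) (rest : List (Move d))
    (hrest : build rest = X ++ (a, true) :: (b, false) :: Y) :
    glued x (pmMoves a b n ++ rest) = (x + disp X - e b, plaqWord a b) :: glued x rest := by
  have h1 : build (Move.backtrack n (b, false) :: rest) = (X ++ [((b, false) : Letter d)]) ++ (b, true) :: (a, true) :: ((b, false) :: Y) := by
    rw [build_backtrack_of_eq _ hrest hX]
    simp
  rw [pmMoves, List.cons_append, List.append_assoc, List.singleton_append, glued,
    glued_ppMoves_append b a x (n := n + 1) (X ++ [((b, false) : Letter d)]) ((b, false) :: Y) (by simp [hX]) _ h1, glued, disp_append]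
  simp [disp_cons, sub_eq_add_neg, add_assoc]

/-- **`mmMoves` SWAPS `a⁻ b⁻ ↦ b⁻ a⁻`.** [folklore] -/
theorem build_mmMoves_append (a b : Fin d) {n : ℕ} (X Y : List (Letter d)) (hX : X.length = n) (rest : List (Move d))
    (hrest : build rest = X ++ (a, false) :: (b, false) :: Y) :
    build (mmMoves a b n ++ rest) = X ++ (b, false) :: (a, false) :: Y := by
  have h1 : build (Move.backtrack n (b, false) :: rest) = (X ++ [((b, false) : Letter d)]) ++ (b, true) :: (a, false) :: ((b, false) :: Y) := by
    rw [build_backtrack_of_eq _ hrest hX]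
    simp
  have h2 := build_pmMoves_append b a (n := n + 1) (X ++ [((b, false) : Letter d)]) ((b, false) :: Y) (by simp [hX]) _ h1
  rw [mmMoves, List.cons_append, List.append_assoc, List.singleton_append,
    build_cancel_of_eq (A := X ++ [((b, false) : Letter d), (a, false)]) (C := Y) _ (by rw [h2]; simp) (by simp [hX])]
  simp

/-- `mmMoves` inserts exactly one word, `∂p_{ba}` … -/
theorem loops_mmMoves_append (a b : Fin d) (n : ℕ) (rest : List (Move d)) :
    loops (mmMoves a b n ++ rest) = plaqWord b a :: loops rest := rfl

/-- … glued at `x + disp X − e_b − e_a`. [folklore] -/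
theorem glued_mmMoves_append (a b : Fin d) (x : Site d) {n : ℕ} (X Y : List (Letter d)) (hX : X.length = n) (rest : List (Move d))
    (hrest : build rest = X ++ (a, false) :: (b, false) :: Y) :
    glued x (mmMoves a b n ++ rest) = (x + disp X - e b - e a, plaqWord b a) :: glued x rest := by
  have h1 : build (Move.backtrack n (b, false) :: rest) = (X ++ [((b, false) : Letter d)]) ++ (b, true) :: (a, false) :: ((b, false) :: Y) := by
    rw [build_backtrack_of_eq _ hrest hX]
    simp
  rw [mmMoves, List.cons_append, List.append_assoc, List.singleton_append, glued,
    glued_pmMoves_append b a x (n := n + 1) (X ++ [((b, false) : Letter d)]) ((b, false) :: Y) (by simp [hX]) _ h1, glued, disp_append]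
  simp [disp_cons, sub_eq_add_neg, add_assoc]

end Signs

/-! ## §4 The transposition script of two arbitrary letters -/

section Swap

/-- DATA.  The orientation of the plaquette glued by the swap `l₁ l₂ ↦ l₂ l₁`: `(b, a)` for equal signs, `(a, b)` for opposite signs
(`l₁ = (a, s)`, `l₂ = (b, t)`). -/
def swapOrient (l₁ l₂ : Letter d) : Fin d × Fin d := if l₁.2 = l₂.2 then (l₂.1, l₁.1) else (l₁.1, l₂.1)

/-- DATA.  The corner of that plaquette relative to the swap point: `−e_a` if `l₁ = a⁻`, `−e_b` if `l₂ = b⁻` (the lower corner of the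
unit square spanned by the two letters). -/
def swapShift (l₁ l₂ : Letter d) : Site d := (if l₁.2 then 0 else -e l₁.1) + (if l₂.2 then 0 else -e l₂.1)

/-- DATA.  THE TRANSPOSITION SCRIPT of the letters `l₁ l₂` at position `n`. -/
def swapMoves : Letter d → Letter d → ℕ → List (Move d)
  | (a, true), (b, true), n => if a = b then [] else ppMoves a b n
  | (a, false), (b, true), n => if a = b then sdMoves a false n else mpMoves a b n
  | (a, true), (b, false), n => if a = b then sdMoves a true n else pmMoves a b n
  | (a, false), (b, false), n => if a = b then [] else mmMoves a b n

/-- **THE TRANSPOSITION SCRIPT SWAPS THE TWO LETTERS**: `build rest = X ++ l₁ l₂ ++ Y`, `|X| = n` ⟹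
`build (swapMoves l₁ l₂ n ++ rest) = X ++ l₂ l₁ ++ Y`. [folklore] -/
theorem build_swapMoves_append (l₁ l₂ : Letter d) {n : ℕ} (X Y : List (Letter d)) (hX : X.length = n) (rest : List (Move d))
    (hrest : build rest = X ++ l₁ :: l₂ :: Y) :
    build (swapMoves l₁ l₂ n ++ rest) = X ++ l₂ :: l₁ :: Y := by
  obtain ⟨a, s⟩ := l₁
  obtain ⟨b, t⟩ := l₂
  cases s <;> cases t
  · -- `a⁻ b⁻`
    by_cases hab : a = b
    · subst hab; rw [swapMoves, if_pos rfl, List.nil_append, hrest]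
    · rw [swapMoves, if_neg hab]; exact build_mmMoves_append a b X Y hX rest hrest
  · -- `a⁻ b⁺`
    by_cases hab : a = b
    · subst hab; rw [swapMoves, if_pos rfl]; exact build_sdMoves_append a false X Y hX rest hrest
    · rw [swapMoves, if_neg hab]; exact build_mpMoves_append a b X Y hX rest hrest
  · -- `a⁺ b⁻`
    by_cases hab : a = b
    · subst hab; rw [swapMoves, if_pos rfl]; exact build_sdMoves_append a true X Y hX rest hrest
    · rw [swapMoves, if_neg hab]; exact build_pmMoves_append a b X Y hX rest hrest
  · -- `a⁺ b⁺`
    by_cases hab : a = b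
    · subst hab; rw [swapMoves, if_pos rfl, List.nil_append, hrest]
    · rw [swapMoves, if_neg hab]; exact build_ppMoves_append a b X Y hX rest hrest

/-- **WHAT THE TRANSPOSITION SCRIPT GLUES**: nothing for parallel letters, otherwise exactly ONE plaquette — `plaqWord (swapOrient l₁ l₂)`
at the corner `x + disp X + swapShift l₁ l₂`. [folklore] -/
theorem glued_swapMoves_append (l₁ l₂ : Letter d) (x : Site d) {n : ℕ} (X Y : List (Letter d)) (hX : X.length = n)
    (rest : List (Move d)) (hrest : build rest = X ++ l₁ :: l₂ :: Y) :
    glued x (swapMoves l₁ l₂ n ++ rest) =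
      (if l₁.1 = l₂.1 then [] else [(x + disp X + swapShift l₁ l₂, plaqWord (swapOrient l₁ l₂).1 (swapOrient l₁ l₂).2)]) ++ glued x rest := by
  obtain ⟨a, s⟩ := l₁
  obtain ⟨b, t⟩ := l₂
  cases s <;> cases t
  · by_cases hab : a = b
    · subst hab; rw [swapMoves, if_pos rfl, if_pos rfl, List.nil_append, List.nil_append]
    · rw [swapMoves, if_neg hab, if_neg hab, glued_mmMoves_append a b x X Y hX rest hrest]
      simp [swapShift, swapOrient, sub_eq_add_neg, add_assoc, add_comm, add_left_comm]
  · by_cases hab : a = b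
    · subst hab; rw [swapMoves, if_pos rfl, if_pos rfl, List.nil_append, glued_sdMoves_append]
    · rw [swapMoves, if_neg hab, if_neg hab, glued_mpMoves_append a b x X Y hX rest hrest]
      simp [swapShift, swapOrient, sub_eq_add_neg]
  · by_cases hab : a = b
    · subst hab; rw [swapMoves, if_pos rfl, if_pos rfl, List.nil_append, glued_sdMoves_append]
    · rw [swapMoves, if_neg hab, if_neg hab, glued_pmMoves_append a b x X Y hX rest hrest]
      simp [swapShift, swapOrient, sub_eq_add_neg]
  · by_cases hab : a = b
    · subst hab; rw [swapMoves, if_pos rfl, if_pos rfl, List.nil_append, List.nil_append]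
    · rw [swapMoves, if_neg hab, if_neg hab, glued_ppMoves_append a b x X Y hX rest hrest]
      simp [swapShift, swapOrient]

/-- **WHAT IT INSERTS**: nothing for parallel letters, otherwise the one plaquette word `plaqWord (swapOrient l₁ l₂)`. [folklore] -/
theorem loops_swapMoves_append (l₁ l₂ : Letter d) (n : ℕ) (rest : List (Move d)) :
    loops (swapMoves l₁ l₂ n ++ rest) =
      (if l₁.1 = l₂.1 then [] else [plaqWord (swapOrient l₁ l₂).1 (swapOrient l₁ l₂).2]) ++ loops rest := by
  obtain ⟨a, s⟩ := l₁
  obtain ⟨b, t⟩ := l₂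
  cases s <;> cases t <;> by_cases hab : a = b <;> simp [swapMoves, swapOrient, hab, sdMoves_append, loops, loops_mmMoves_append,
    loops_mpMoves_append, loops_pmMoves_append, loops_ppMoves_append]

/-- Hence a transposition glues AT MOST ONE plaquette … -/
theorem length_glued_swapMoves_append_le (l₁ l₂ : Letter d) (x : Site d) {n : ℕ} (X Y : List (Letter d)) (hX : X.length = n)
    (rest : List (Move d)) (hrest : build rest = X ++ l₁ :: l₂ :: Y) :
    (glued x (swapMoves l₁ l₂ n ++ rest)).length ≤ (glued x rest).length + 1 := by
  rw [glued_swapMoves_append l₁ l₂ x X Y hX rest hrest, List.length_append]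
  split_ifs <;> simp [Nat.add_comm]

/-- … exactly none when the letters are parallel … -/
theorem glued_swapMoves_append_of_fst_eq (l₁ l₂ : Letter d) (h : l₁.1 = l₂.1) (x : Site d) {n : ℕ} (X Y : List (Letter d))
    (hX : X.length = n) (rest : List (Move d)) (hrest : build rest = X ++ l₁ :: l₂ :: Y) :
    glued x (swapMoves l₁ l₂ n ++ rest) = glued x rest := by
  rw [glued_swapMoves_append l₁ l₂ x X Y hX rest hrest, if_pos h, List.nil_append]

/-- … and every word it inserts is a NON-DEGENERATE plaquette contour `plaqWord a b`, `a ≠ b`. [folklore] -/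
theorem exists_eq_plaqWord_of_mem_loops_swapMoves_append (l₁ l₂ : Letter d) (n : ℕ) (rest : List (Move d)) {σ : List (Letter d)}
    (hσ : σ ∈ loops (swapMoves l₁ l₂ n ++ rest)) : σ ∈ loops rest ∨ ∃ a b : Fin d, a ≠ b ∧ σ = plaqWord a b := by
  rw [loops_swapMoves_append, List.mem_append] at hσ
  rcases hσ with hσ | hσ
  · split_ifs at hσ with h
    · simp at hσ
    · right
      have hσ' : σ = plaqWord (swapOrient l₁ l₂).1 (swapOrient l₁ l₂).2 := by simpa using hσ
      refine ⟨_, _, ?_, hσ'⟩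
      unfold swapOrient
      split_ifs
      · exact fun h' => h h'.symm
      · exact h
  · exact Or.inl hσ

end Swap

/-! ## §5 Toys -/

section Toys

/-- `a⁺ b⁺ ↦ b⁺ a⁺` on the bare two-letter word (`rest` = one loop move writing `a⁺b⁺`, itself glued as a «loop» — a toy). -/
example (a b : Fin d) (hab : a ≠ b) :
    build (swapMoves ((a, true) : Letter d) (b, true) 0 ++ [Move.loop 0 [((a, true) : Letter d), (b, true)]]) =
      [((b, true) : Letter d), (a, true)] := by
  have h := build_swapMoves_append ((a, true) : Letter d) (b, true) [] [] rfl [Move.loop 0 [((a, true) : Letter d), (b, true)]]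
    (by simp [build, Move.apply])
  simpa [swapMoves, hab] using h

/-- The `a⁻ b⁻` case by computation: `a⁻b⁻ ↦ b⁻a⁻`, seven moves, one plaquette `∂p_{ba}`. -/
example (a b : Fin d) :
    (loops (mmMoves a b 0 ++ ([] : List (Move d)))).length = 1 ∧ (mmMoves a b 0).length = 7 := by
  simp [loops, mmMoves, pmMoves, ppMoves]

end Toys

end Summit.QuantumFields.BalabanUV.T4Continuum.NE7b.NonAbelianStokesTransposition
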